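import Summits.HubbardSuperconductivity.HubbardSuperconductivity.Theorems.FunctionFieldCertificateWindowInfraredBoundReductions

/-!
# Crux `WindowInfraredBound` (stmt-HubbardSuperconductivity-1089) — ideator 5, round 2:
# the MESOSCOPIC CEILING / block-coherence form of the window half (idea `mesoscopic-ceiling-block-coherence`)

First-lemma sketch (elaborates; proofs are the crux-plan seat's job).  Notation: `P_x = localPair d L x`,
`B_a = Σ_{u ∈ [0,R)²} P_{a+u}` (blocks, as in `FunctionFieldCertificateAssemblyFejerGlue`),
`Δ_d = pairField d L = R⁻² Σ_a B_a`, `S_ψ(m) = pairStructureFactor d L ψ m = ‖Δ_d(m)ψ‖²/L²`.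

* `blockOrder L R ψ = R⁻² Σ_{x,y} Πᵢ (1 - |(y-x)ᵢ|_L/R)₊ Re⟨P_x ψ, P_y ψ⟩ = Σ_a ‖B_a ψ‖² / R⁴`
  (tent identity `re_sum_star_blockMulVec_dotProduct_eq`): the Fejér block ORDER at scale `R`, in the
  normalisation in which the route's `MesoscopicPairOrder` reads `blockOrder L R ψ ≥ m L²`.
* `S_ψ(0) = ‖Δ_d ψ‖²/L²`: the CONDENSATE, same normalisation (`a L²` for LRO density `a`).
* Kinematics (Cauchy–Schwarz over the `L²` block positions, `Σ_a B_a = R² Δ_d`):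
  `blockOrder L R ψ - S_ψ(0) = (2 L² R⁴)⁻¹ Σ_{a,b} ‖B_a ψ - B_b ψ‖² ≥ 0` (`blockOrder_sub_eq_misalignment`).
* (MC) `MesoscopicCeiling`: in every sector ground state, `blockOrder L R ψ - S_ψ(0) ≤ C L²/R` for all
  `R₀ ≤ R ≤ L/2` — "mesoscopic pair order never exceeds condensate order by more than `C/R` per site",
  equivalently "the block pair-removal vectors `B_a ψ` are aligned in mean square up to `2 C R³ L²·L²/L²`".
* `windowSum_le_fejerMajorant` (glue, provable now): Fejér MAJORANT of the window indicator —
  `Σ_{m ≠ 0, |q_m| ≤ ε} S_ψ(m) ≤ (π⁴/16)(blockOrder L R ψ - S_ψ(0))` whenever `ε R ≤ π`, `2R ≤ L`, for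
  EVERY Fock vector (block Plancherel `Σ_a ‖B_aψ‖² = Σ_m |F(m)|² S_ψ(m)`, `|F(m)|² ≥ 16R⁴/π⁴` on the
  window by Jordan's inequality, `F(0) = R²`, `|F|² ≥ 0`, `S ≥ 0`).
* `wib_of_mesoscopicCeiling : MesoscopicCeiling → FunctionFieldCertificate.WindowInfraredBound`
  (composition: `ε₀ := π / max R₀ 2`, `R := ⌊π/ε⌋`, empty window below `ε L < 2π`, `C_crux = (π³/8) C`).
-/

noncomputable section

set_option linter.dupNamespace false

namespace Summit.HubbardSuperconductivity.HubbardSuperconductivity.Cruxes.WindowInfraredBound.MesoscopicCeiling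

open Literature.MathematicalPhysics.QuantumLattice Literature.Probability.LatticeModels Matrix Finset
open scoped ComplexOrder ComplexConjugate
open Summit.HubbardSuperconductivity.HubbardSuperconductivity.Theses

/-- **Fejér block order at scale `R`**: `R⁻² Σ_{x,y} Πᵢ (1 - |(y-x)ᵢ|_L/R)₊ Re⟨P_x ψ, P_y ψ⟩`
(`= Σ_a ‖B_a ψ‖²/R⁴` by the tree's tent identity); route item `MesoscopicPairOrder` asserts
`blockOrder L R ψ ≥ m L²` at arbitrarily large `R`. [folklore] -/
def blockOrder (L : ℕ) [NeZero L] (R : ℕ) (ψ : Fock (Orb (FermionTorus 2 L))) : ℝ :=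
  (∑ x : TorusSite 2 L, ∑ y : TorusSite 2 L,
      (∏ i : Fin 2, max 0 (1 - |(((y i - x i).valMinAbs : ℤ) : ℝ)| / (R : ℝ))) *
        (star (localPair dWaveFormFactor L x *ᵥ ψ) ⬝ᵥ (localPair dWaveFormFactor L y *ᵥ ψ)).re) /
    (R : ℝ) ^ 2

/-- **(MC) MESOSCOPIC CEILING** — the transfer target `C⁺` of idea `mesoscopic-ceiling-block-coherence`:
for all `U > 0`, `δ ∈ (0, 1/2)` there are `C ≥ 0`, `R₀`, `L₀` such that for every even `L ≥ L₀`, every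
normalised `(N_L, S^z = 0)`-sector ground state `ψ` of `hubbardTorus 2 L 1 U` and every block scale
`R₀ ≤ R ≤ L/2`: `blockOrder L R ψ - S_ψ(0) ≤ C L² / R` — mesoscopic `d`-wave pair order exceeds the
`k = 0` condensate by at most `C/R` per site. [folklore] -/
def MesoscopicCeiling : Prop :=
  ∀ U : ℝ, 0 < U → ∀ δ ∈ Set.Ioo (0:ℝ) (1 / 2), ∃ C : ℝ, 0 ≤ C ∧ ∃ R₀ L₀ : ℕ,
    ∀ (L : ℕ) [NeZero L], L₀ ≤ L → Even L → ∀ ψ : Fock (Orb (FermionTorus 2 L)), star ψ ⬝ᵥ ψ = 1 →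
      IsGroundStateInSector (hubbardTorus 2 L 1 U) (2 * ⌊(1 - δ) * (L : ℝ) ^ 2 / 2⌋₊) 0 ψ →
        ∀ R : ℕ, R₀ ≤ R → 2 * R ≤ L →
          blockOrder L R ψ - pairStructureFactor dWaveFormFactor L ψ 0 ≤ C * (L : ℝ) ^ 2 / (R : ℝ)

/-- **Block-coherence identity** (kinematics, provable now): with `B_a = Σ_{u ∈ [0,R)²} P_{a+u}`,
`R⁴ (blockOrder L R ψ - S_ψ(0)) = (2L²)⁻¹ Σ_{a,b} ‖B_a ψ - B_b ψ‖²` — the Cauchy–Schwarz defect of the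
`L²` block pair-removal vectors, since `Σ_a B_a = R² Δ_d` and `Σ_a ‖B_aψ‖² = R⁴ · blockOrder`
(tent identity). In particular `blockOrder L R ψ ≥ S_ψ(0)` for every Fock vector. [folklore] -/
theorem blockOrder_sub_eq_misalignment (L : ℕ) [NeZero L] (R : ℕ) (hR : 0 < R) (hRL : 2 * R ≤ L)
    (ψ : Fock (Orb (FermionTorus 2 L))) :
    (R : ℝ) ^ 4 * (blockOrder L R ψ - pairStructureFactor dWaveFormFactor L ψ 0) =
      (∑ a : TorusSite 2 L, ∑ b : TorusSite 2 L,
        (star (((∑ u : Fin 2 → Fin R, localPair dWaveFormFactor L (a + fun i => ((u i : ℕ) : ZMod L))) *ᵥ ψ) -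
              ((∑ u : Fin 2 → Fin R, localPair dWaveFormFactor L (b + fun i => ((u i : ℕ) : ZMod L))) *ᵥ ψ)) ⬝ᵥ
          (((∑ u : Fin 2 → Fin R, localPair dWaveFormFactor L (a + fun i => ((u i : ℕ) : ZMod L))) *ᵥ ψ) -
              ((∑ u : Fin 2 → Fin R, localPair dWaveFormFactor L (b + fun i => ((u i : ℕ) : ZMod L))) *ᵥ ψ))).re) /
        (2 * (L : ℝ) ^ 2) := by
  sorry

/-- **Fejér MAJORANT of the window** (glue, provable now; dual to the landed `fejer_glue`, which is
the MINORANT direction): for `0 < R`, `2R ≤ L`, `0 < ε` with `ε R ≤ π`, and EVERY Fock vector `ψ`,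
`Σ_{m ≠ 0, |q_m| ≤ ε} S_ψ(m) ≤ (π⁴/16) · (blockOrder L R ψ - S_ψ(0))`.
Proof route: block Plancherel `Σ_a ‖B_aψ‖² = Σ_m |F(m)|² S_ψ(m)` with `F(m) = Πᵢ Σ_{v<R} e^{i q_{m,i} v}`;
`F(0) = R²`; `|F(m)|² ≥ 0`; on the window each `|q_{m,i}| ≤ ε ≤ π/R`, so Jordan's inequality gives
`|Σ_{v<R} e^{ikv}|² = sin²(Rk/2)/sin²(k/2) ≥ 4R²/π²`, i.e. `|F(m)|² ≥ 16R⁴/π⁴`; and `S_ψ ≥ 0`.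
[cite: KLS1988PRL, p. 2582] -/
theorem windowSum_le_fejerMajorant (L : ℕ) [NeZero L] (R : ℕ) (hR : 0 < R) (hRL : 2 * R ≤ L)
    {ε : ℝ} (hε : 0 < ε) (hεR : ε * R ≤ Real.pi) (ψ : Fock (Orb (FermionTorus 2 L))) :
    (∑ m : TorusSite 2 L, if m ≠ 0 ∧ momentumNormSq L m ≤ ε ^ 2 then
        pairStructureFactor dWaveFormFactor L ψ m else 0) ≤
      Real.pi ^ 4 / 16 * (blockOrder L R ψ - pairStructureFactor dWaveFormFactor L ψ 0) := by
  sorry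

/-- **The line's composition**: (MC) closes the crux BY NAME (`C_crux = (π³/8)·C`,
`ε₀ = π / max R₀ 2`; for `ε L < 2π` the window is empty, `windowSum_eq_zero_of_sq_lt`-style; else
`R := ⌊π/ε⌋ ≥ R₀`, `2R ≤ L`, `ε R ≤ π`, `1/R ≤ 2ε/π`, and `windowSum_le_fejerMajorant`). [folklore] -/
theorem wib_of_mesoscopicCeiling (h : MesoscopicCeiling) :
    FunctionFieldCertificate.WindowInfraredBound := by
  sorry

/-- The KacWindowPenalty / GibbsMajorant copy (same term, `wib_functionField_iff_kac`). [folklore] -/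
theorem kacWib_of_mesoscopicCeiling (h : MesoscopicCeiling) :
    KacWindowPenalty.WindowInfraredBound :=
  Theorems.wib_functionField_iff_kac.1 (wib_of_mesoscopicCeiling h)

end Summit.HubbardSuperconductivity.HubbardSuperconductivity.Cruxes.WindowInfraredBound.MesoscopicCeiling

end
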